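import Summits.CriticalPhenomena.PercolationContinuityZ3.Theorems.PercNearOneGluingNoHeavyLowerTailMajorityGluingSix
import HarnessLib

/-!
# The exchange inequality (C1*) for three relays outside its one open regime — two applications of van den Berg–Kahn's Theorem 1.1
# (lane prim-rate, constants-miner 1, gen 4 — `prim-rate-mine-1/CANDIDATES.md` §GEN-4 R17/R20)

Support file for the closed crux `NoHeavyLowerTail` (stmt-CriticalPhenomena-4575; `--supports … --as helper`).

SETTING.  Bernoulli bond percolation `μ = prodBernoulli w` on `Fin n`, a hub `a₀` and three vertices `v₁, v₂, v₃`; `Jᵢ = {a₀ ↔ vᵢ}` and the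
eight ATOMS `p_{b₁b₂b₃} = μ(⋂ᵢ (Jᵢ if bᵢ = 0, Jᵢᶜ if bᵢ = 1))` of the cut-indicator law (`bᵢ = 1` ⟺ `vᵢ` cut from `a₀`); below an atom is
written as the measure of `J₁^{±} ∩ J₂^{±} ∩ J₃^{±}` in this fixed order.  The MINED inequality of the lane (row M1-C1STAR),

  (C1*)  `p₀₁₁ · p₁₀₁ ≤ p₁₀₀ · p₀₁₀`  whenever `δ₃ ≤ δ₁`, `δ₃ ≤ δ₂`, `δ₃ ≤ 1/2` (`δᵢ = μ(Jᵢᶜ)`),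

implies the majority-of-three percolation-EKR bound and hence majority gluing with loss `2·max` at `|A| = 6, 7`
(`…MajorityGluingMajThree.lean`).  THIS FILE proves, with no hypothesis at all, the three instances of van den Berg–Kahn's Theorem 1.1
(`s = a₀`, conditioning vertex `t = v₂ / v₁ / v₃`) written in atoms,

  (V1) `p₀₁₁·p₁₁₀ ≤ p₀₁₀·p₁₁₁`,   (V2) `p₁₀₁·p₁₁₀ ≤ p₁₀₀·p₁₁₁`,   (V3) `p₀₁₁·p₁₀₁ ≤ p₀₀₁·p₁₁₁`,

their product consequence **`p₀₁₁·p₁₀₁·p₁₁₀² ≤ p₁₀₀·p₀₁₀·p₁₁₁²`** (`c1star_double`), and therefore **(C1*) in the regime `p₁₁₁ ≤ p₁₁₀`**, i.e.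
whenever `μ(v₃ cut | v₁, v₂ both cut) ≤ 1/2` (`c1star_of_allCut_le`) — for every graph, with no marginal hypothesis; and, by pure
arithmetic from the two exchange identities `δ₁ − δ₃ = p₁₀₀ + p₁₁₀ − p₀₀₁ − p₀₁₁`, `δ₂ − δ₃ = p₀₁₀ + p₁₁₀ − p₀₀₁ − p₁₀₁`, (C1*) in the regime
`p₀₀₁ ≥ p₁₁₀` (`c1star_of_alone_ge`).  What remains OPEN of (C1*) is exactly the regime `p₁₁₁ > p₁₁₀ > p₀₀₁` («`v₃` is cut with
probability `> 1/2` once `v₁, v₂` are both cut, yet escapes a double cut more often than it is cut alone»), where the lane's exact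
hypergraph witness lives (CANDIDATES §GEN-4 R18) — so the missing step is necessarily bond-specific.  No definitions, no named facts,
no sorries. [cite: VandenbergKahn2001, Thm 1.1 (p. 123)]
-/

noncomputable section

namespace Summit.CriticalPhenomena.PercolationContinuityZ3.Theorems

open MeasureTheory Set
open Literature.Probability.LatticeModels (prodBernoulli)
open Literature.Probability.Percolation
open scoped Classical

namespace HubOnly

variable {n : ℕ}

/-- Splitting a real measure along an event: `μ(A) = μ(A ∩ B) + μ(A ∩ Bᶜ)` (finite configuration space). [folklore] -/
theorem real_split (w : Sym2 (Fin n) → unitInterval) (A B : Set (BondConfig (Fin n))) :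
    (prodBernoulli w).real A = (prodBernoulli w).real (A ∩ B) + (prodBernoulli w).real (A ∩ Bᶜ) := by
  have h := measureReal_inter_add_sdiff (μ := prodBernoulli w) (s := A) (t := B) MeasurableSet.of_discrete
  rw [Set.sdiff_eq] at h
  linarith

/-- **van den Berg–Kahn's Theorem 1.1 in atoms (instance (V1), conditioning vertex `v₂`)**: with `Jᵢ = {a₀ ↔ vᵢ}`,
`μ(J₁ ∩ J₂ᶜ ∩ J₃ᶜ)·μ(J₁ᶜ ∩ J₂ᶜ ∩ J₃) ≤ μ(J₁ ∩ J₂ᶜ ∩ J₃)·μ(J₁ᶜ ∩ J₂ᶜ ∩ J₃ᶜ)`, i.e. `p₀₁₁·p₁₁₀ ≤ p₀₁₀·p₁₁₁`: given `v₂` cut, the events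
`{v₁ joined}` and `{v₃ joined}` are positively correlated.  Proof: Theorem 1.1 with `(s, a, b, t) = (a₀, v₁, v₃, v₂)` reads
`μ(J₁ ∩ J₂ᶜ)·μ(J₃ ∩ J₂ᶜ) ≤ μ(J₁ ∩ J₃ ∩ J₂ᶜ)·μ(J₂ᶜ)`; split each factor into atoms. [cite: VandenbergKahn2001, Thm 1.1 (p. 123)] -/
theorem vdBK_atoms (w : Sym2 (Fin n) → unitInterval) (a₀ v₁ v₂ v₃ : Fin n) :
    (prodBernoulli w).real (openConn a₀ v₁ ∩ (openConn a₀ v₂)ᶜ ∩ (openConn a₀ v₃)ᶜ) *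
        (prodBernoulli w).real ((openConn a₀ v₁)ᶜ ∩ (openConn a₀ v₂)ᶜ ∩ openConn a₀ v₃) ≤
      (prodBernoulli w).real (openConn a₀ v₁ ∩ (openConn a₀ v₂)ᶜ ∩ openConn a₀ v₃) *
        (prodBernoulli w).real ((openConn a₀ v₁)ᶜ ∩ (openConn a₀ v₂)ᶜ ∩ (openConn a₀ v₃)ᶜ) := by
  set μ := prodBernoulli w with hμ
  set J1 : Set (BondConfig (Fin n)) := openConn a₀ v₁ with hJ1
  set J2 : Set (BondConfig (Fin n)) := openConn a₀ v₂ with hJ2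
  set J3 : Set (BondConfig (Fin n)) := openConn a₀ v₃ with hJ3
  have h := Literature.Probability.Percolation.BergKahn.bergKahn_thm_1_1 w a₀ v₁ v₃ v₂
  simp only [← hμ, ← hJ1, ← hJ2, ← hJ3] at h
  -- atoms
  set p010 := μ.real (J1 ∩ J2ᶜ ∩ J3) with hp010
  set p011 := μ.real (J1 ∩ J2ᶜ ∩ J3ᶜ) with hp011
  set p110 := μ.real (J1ᶜ ∩ J2ᶜ ∩ J3) with hp110
  set p111 := μ.real (J1ᶜ ∩ J2ᶜ ∩ J3ᶜ) with hp111
  -- the four factors of Theorem 1.1 in atoms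
  have e1 : μ.real (J1 ∩ J2ᶜ) = p010 + p011 := real_split w (J1 ∩ J2ᶜ) J3
  have s2 : J3 ∩ J2ᶜ = J2ᶜ ∩ J3 := Set.inter_comm _ _
  have s2a : J2ᶜ ∩ J3 ∩ J1 = J1 ∩ J2ᶜ ∩ J3 := by ext ω; simp only [mem_inter_iff, mem_compl_iff]; tauto
  have s2b : J2ᶜ ∩ J3 ∩ J1ᶜ = J1ᶜ ∩ J2ᶜ ∩ J3 := by ext ω; simp only [mem_inter_iff, mem_compl_iff]; tauto
  have e2 : μ.real (J3 ∩ J2ᶜ) = p010 + p110 := by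
    rw [s2, real_split w (J2ᶜ ∩ J3) J1, s2a, s2b]
  have s3 : J1 ∩ J3 ∩ J2ᶜ = J1 ∩ J2ᶜ ∩ J3 := by ext ω; simp only [mem_inter_iff, mem_compl_iff]; tauto
  have e3 : μ.real (J1 ∩ J3 ∩ J2ᶜ) = p010 := by rw [s3]
  have s4a : J2ᶜ ∩ J1 = J1 ∩ J2ᶜ := Set.inter_comm _ _
  have s4b : J2ᶜ ∩ J1ᶜ ∩ J3 = J1ᶜ ∩ J2ᶜ ∩ J3 := by ext ω; simp only [mem_inter_iff, mem_compl_iff]; tauto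
  have s4c : J2ᶜ ∩ J1ᶜ ∩ J3ᶜ = J1ᶜ ∩ J2ᶜ ∩ J3ᶜ := by ext ω; simp only [mem_inter_iff, mem_compl_iff]; tauto
  have e4 : μ.real J2ᶜ = p010 + p011 + (p110 + p111) := by
    rw [real_split w J2ᶜ J1, s4a, e1, real_split w (J2ᶜ ∩ J1ᶜ) J3, s4b, s4c]
  rw [e1, e2, e3, e4] at h
  have h010 : 0 ≤ p010 := measureReal_nonneg
  have h011 : 0 ≤ p011 := measureReal_nonneg
  have h110 : 0 ≤ p110 := measureReal_nonneg
  have h111 : 0 ≤ p111 := measureReal_nonneg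
  nlinarith [h]

/-- (V2) = `vdBK_atoms` with the roles of `v₁, v₂` exchanged: `p₁₀₁·p₁₁₀ ≤ p₁₀₀·p₁₁₁` (given `v₁` cut, `{v₂ joined}` and `{v₃ joined}` are
positively correlated). [cite: VandenbergKahn2001, Thm 1.1 (p. 123)] -/
theorem vdBK_atoms₂ (w : Sym2 (Fin n) → unitInterval) (a₀ v₁ v₂ v₃ : Fin n) :
    (prodBernoulli w).real ((openConn a₀ v₁)ᶜ ∩ openConn a₀ v₂ ∩ (openConn a₀ v₃)ᶜ) *
        (prodBernoulli w).real ((openConn a₀ v₁)ᶜ ∩ (openConn a₀ v₂)ᶜ ∩ openConn a₀ v₃) ≤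
      (prodBernoulli w).real ((openConn a₀ v₁)ᶜ ∩ openConn a₀ v₂ ∩ openConn a₀ v₃) *
        (prodBernoulli w).real ((openConn a₀ v₁)ᶜ ∩ (openConn a₀ v₂)ᶜ ∩ (openConn a₀ v₃)ᶜ) := by
  have h := vdBK_atoms w a₀ v₂ v₁ v₃
  have t1 : openConn a₀ v₂ ∩ (openConn a₀ v₁)ᶜ ∩ (openConn a₀ v₃)ᶜ =
      ((openConn a₀ v₁)ᶜ ∩ openConn a₀ v₂ ∩ (openConn a₀ v₃)ᶜ : Set (BondConfig (Fin n))) := by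
    ext ω; simp only [mem_inter_iff, mem_compl_iff]; tauto
  have t2 : (openConn a₀ v₂)ᶜ ∩ (openConn a₀ v₁)ᶜ ∩ openConn a₀ v₃ =
      ((openConn a₀ v₁)ᶜ ∩ (openConn a₀ v₂)ᶜ ∩ openConn a₀ v₃ : Set (BondConfig (Fin n))) := by
    ext ω; simp only [mem_inter_iff, mem_compl_iff]; tauto
  have t3 : openConn a₀ v₂ ∩ (openConn a₀ v₁)ᶜ ∩ openConn a₀ v₃ =
      ((openConn a₀ v₁)ᶜ ∩ openConn a₀ v₂ ∩ openConn a₀ v₃ : Set (BondConfig (Fin n))) := by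
    ext ω; simp only [mem_inter_iff, mem_compl_iff]; tauto
  have t4 : (openConn a₀ v₂)ᶜ ∩ (openConn a₀ v₁)ᶜ ∩ (openConn a₀ v₃)ᶜ =
      ((openConn a₀ v₁)ᶜ ∩ (openConn a₀ v₂)ᶜ ∩ (openConn a₀ v₃)ᶜ : Set (BondConfig (Fin n))) := by
    ext ω; simp only [mem_inter_iff, mem_compl_iff]; tauto
  rw [t1, t2, t3, t4] at h
  exact h

/-- (V3) = `vdBK_atoms` with conditioning vertex `v₃`: `p₀₁₁·p₁₀₁ ≤ p₀₀₁·p₁₁₁` (given `v₃` cut, `{v₁ joined}` and `{v₂ joined}` are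
positively correlated). [cite: VandenbergKahn2001, Thm 1.1 (p. 123)] -/
theorem vdBK_atoms₃ (w : Sym2 (Fin n) → unitInterval) (a₀ v₁ v₂ v₃ : Fin n) :
    (prodBernoulli w).real (openConn a₀ v₁ ∩ (openConn a₀ v₂)ᶜ ∩ (openConn a₀ v₃)ᶜ) *
        (prodBernoulli w).real ((openConn a₀ v₁)ᶜ ∩ openConn a₀ v₂ ∩ (openConn a₀ v₃)ᶜ) ≤
      (prodBernoulli w).real (openConn a₀ v₁ ∩ openConn a₀ v₂ ∩ (openConn a₀ v₃)ᶜ) *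
        (prodBernoulli w).real ((openConn a₀ v₁)ᶜ ∩ (openConn a₀ v₂)ᶜ ∩ (openConn a₀ v₃)ᶜ) := by
  have h := vdBK_atoms w a₀ v₁ v₃ v₂
  have t1 : openConn a₀ v₁ ∩ (openConn a₀ v₃)ᶜ ∩ (openConn a₀ v₂)ᶜ =
      (openConn a₀ v₁ ∩ (openConn a₀ v₂)ᶜ ∩ (openConn a₀ v₃)ᶜ : Set (BondConfig (Fin n))) := by
    ext ω; simp only [mem_inter_iff, mem_compl_iff]; tauto
  have t2 : (openConn a₀ v₁)ᶜ ∩ (openConn a₀ v₃)ᶜ ∩ openConn a₀ v₂ =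
      ((openConn a₀ v₁)ᶜ ∩ openConn a₀ v₂ ∩ (openConn a₀ v₃)ᶜ : Set (BondConfig (Fin n))) := by
    ext ω; simp only [mem_inter_iff, mem_compl_iff]; tauto
  have t3 : openConn a₀ v₁ ∩ (openConn a₀ v₃)ᶜ ∩ openConn a₀ v₂ =
      (openConn a₀ v₁ ∩ openConn a₀ v₂ ∩ (openConn a₀ v₃)ᶜ : Set (BondConfig (Fin n))) := by
    ext ω; simp only [mem_inter_iff, mem_compl_iff]; tauto
  have t4 : (openConn a₀ v₁)ᶜ ∩ (openConn a₀ v₃)ᶜ ∩ (openConn a₀ v₂)ᶜ =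
      ((openConn a₀ v₁)ᶜ ∩ (openConn a₀ v₂)ᶜ ∩ (openConn a₀ v₃)ᶜ : Set (BondConfig (Fin n))) := by
    ext ω; simp only [mem_inter_iff, mem_compl_iff]; tauto
  rw [t1, t2, t3, t4] at h
  exact h

/-- **The double van den Berg–Kahn inequality** (V1)×(V2): `p₀₁₁·p₁₀₁·p₁₁₀² ≤ p₁₀₀·p₀₁₀·p₁₁₁²` — for every finite weighted graph, hub
and three vertices, no hypothesis.  In words: `μ(H={v₂,v₃})·μ(H={v₁,v₃})·μ(H={v₁,v₂})² ≤ μ(H={v₁})·μ(H={v₂})·μ(H={v₁,v₂,v₃})²`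
for the cut set `H`. [cite: VandenbergKahn2001, Thm 1.1 (p. 123)] -/
theorem c1star_double (w : Sym2 (Fin n) → unitInterval) (a₀ v₁ v₂ v₃ : Fin n) :
    (prodBernoulli w).real (openConn a₀ v₁ ∩ (openConn a₀ v₂)ᶜ ∩ (openConn a₀ v₃)ᶜ) *
        (prodBernoulli w).real ((openConn a₀ v₁)ᶜ ∩ openConn a₀ v₂ ∩ (openConn a₀ v₃)ᶜ) *
        (prodBernoulli w).real ((openConn a₀ v₁)ᶜ ∩ (openConn a₀ v₂)ᶜ ∩ openConn a₀ v₃) ^ 2 ≤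
      (prodBernoulli w).real ((openConn a₀ v₁)ᶜ ∩ openConn a₀ v₂ ∩ openConn a₀ v₃) *
        (prodBernoulli w).real (openConn a₀ v₁ ∩ (openConn a₀ v₂)ᶜ ∩ openConn a₀ v₃) *
        (prodBernoulli w).real ((openConn a₀ v₁)ᶜ ∩ (openConn a₀ v₂)ᶜ ∩ (openConn a₀ v₃)ᶜ) ^ 2 := by
  have h1 := vdBK_atoms w a₀ v₁ v₂ v₃
  have h2 := vdBK_atoms₂ w a₀ v₁ v₂ v₃
  have a : 0 ≤ (prodBernoulli w).real (openConn a₀ v₁ ∩ (openConn a₀ v₂)ᶜ ∩ (openConn a₀ v₃)ᶜ) := measureReal_nonneg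
  have b : 0 ≤ (prodBernoulli w).real ((openConn a₀ v₁)ᶜ ∩ (openConn a₀ v₂)ᶜ ∩ openConn a₀ v₃) := measureReal_nonneg
  have c : 0 ≤ (prodBernoulli w).real ((openConn a₀ v₁)ᶜ ∩ openConn a₀ v₂ ∩ (openConn a₀ v₃)ᶜ) := measureReal_nonneg
  have hm := mul_le_mul h1 h2 (mul_nonneg c b) (le_trans (mul_nonneg a b) h1)
  nlinarith [hm]

/-- **(C1*) in the regime `p₁₁₁ ≤ p₁₁₀`** («`v₃` is joined with probability `≥ 1/2` even when `v₁, v₂` are both cut»): then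
`p₀₁₁·p₁₀₁ ≤ p₁₀₀·p₀₁₀` — every graph, no marginal hypothesis.  (If `p₁₁₀ = 0` then `p₁₁₁ = 0` and (V3) gives `p₀₁₁ p₁₀₁ ≤ 0`; else cancel
`p₁₁₀²` in `c1star_double`.) [cite: VandenbergKahn2001, Thm 1.1 (p. 123)] -/
theorem c1star_of_allCut_le (w : Sym2 (Fin n) → unitInterval) (a₀ v₁ v₂ v₃ : Fin n)
    (hreg : (prodBernoulli w).real ((openConn a₀ v₁)ᶜ ∩ (openConn a₀ v₂)ᶜ ∩ (openConn a₀ v₃)ᶜ) ≤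
      (prodBernoulli w).real ((openConn a₀ v₁)ᶜ ∩ (openConn a₀ v₂)ᶜ ∩ openConn a₀ v₃)) :
    (prodBernoulli w).real (openConn a₀ v₁ ∩ (openConn a₀ v₂)ᶜ ∩ (openConn a₀ v₃)ᶜ) *
        (prodBernoulli w).real ((openConn a₀ v₁)ᶜ ∩ openConn a₀ v₂ ∩ (openConn a₀ v₃)ᶜ) ≤
      (prodBernoulli w).real ((openConn a₀ v₁)ᶜ ∩ openConn a₀ v₂ ∩ openConn a₀ v₃) *
        (prodBernoulli w).real (openConn a₀ v₁ ∩ (openConn a₀ v₂)ᶜ ∩ openConn a₀ v₃) := by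
  set p011 := (prodBernoulli w).real (openConn a₀ v₁ ∩ (openConn a₀ v₂)ᶜ ∩ (openConn a₀ v₃)ᶜ) with hp011
  set p101 := (prodBernoulli w).real ((openConn a₀ v₁)ᶜ ∩ openConn a₀ v₂ ∩ (openConn a₀ v₃)ᶜ) with hp101
  set p100 := (prodBernoulli w).real ((openConn a₀ v₁)ᶜ ∩ openConn a₀ v₂ ∩ openConn a₀ v₃) with hp100
  set p010 := (prodBernoulli w).real (openConn a₀ v₁ ∩ (openConn a₀ v₂)ᶜ ∩ openConn a₀ v₃) with hp010
  set p110 := (prodBernoulli w).real ((openConn a₀ v₁)ᶜ ∩ (openConn a₀ v₂)ᶜ ∩ openConn a₀ v₃) with hp110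
  set p111 := (prodBernoulli w).real ((openConn a₀ v₁)ᶜ ∩ (openConn a₀ v₂)ᶜ ∩ (openConn a₀ v₃)ᶜ) with hp111
  set p001 := (prodBernoulli w).real (openConn a₀ v₁ ∩ openConn a₀ v₂ ∩ (openConn a₀ v₃)ᶜ) with hp001
  have hd : p011 * p101 * p110 ^ 2 ≤ p100 * p010 * p111 ^ 2 := c1star_double w a₀ v₁ v₂ v₃
  have h3 : p011 * p101 ≤ p001 * p111 := vdBK_atoms₃ w a₀ v₁ v₂ v₃
  have h011 : 0 ≤ p011 := measureReal_nonneg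
  have h101 : 0 ≤ p101 := measureReal_nonneg
  have h100 : 0 ≤ p100 := measureReal_nonneg
  have h010 : 0 ≤ p010 := measureReal_nonneg
  have h110 : 0 ≤ p110 := measureReal_nonneg
  have h111 : 0 ≤ p111 := measureReal_nonneg
  by_cases hz : p110 = 0
  · have h0 : p111 = 0 := le_antisymm (by simpa [hz] using hreg) h111
    have h3' : p011 * p101 ≤ 0 := by rw [h0, mul_zero] at h3; exact h3
    nlinarith [mul_nonneg h100 h010, h3']
  · have hpos : 0 < p110 := lt_of_le_of_ne h110 (Ne.symm hz)
    -- `p011 p101 p110² ≤ p100 p010 p111² ≤ p100 p010 p110²`, cancel `p110² > 0`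
    have hsq : p111 ^ 2 ≤ p110 ^ 2 := pow_le_pow_left₀ h111 hreg 2
    have h2 : p011 * p101 * p110 ^ 2 ≤ p100 * p010 * p110 ^ 2 :=
      hd.trans (mul_le_mul_of_nonneg_left hsq (mul_nonneg h100 h010))
    have hsqpos : 0 < p110 ^ 2 := by positivity
    exact le_of_mul_le_mul_right h2 hsqpos

/-- **(C1*) in the regime `p₀₀₁ ≥ p₁₁₀`** (pure arithmetic): the exchange identities `δ₁ − δ₃ = (p₁₀₀ + p₁₁₀) − (p₀₀₁ + p₀₁₁) ≥ 0` and
`δ₂ − δ₃ = (p₀₁₀ + p₁₁₀) − (p₀₀₁ + p₁₀₁) ≥ 0` give `p₁₀₀ ≥ u + p₀₁₁`, `p₀₁₀ ≥ u + p₁₀₁` with `u = p₀₀₁ − p₁₁₀ ≥ 0`, hence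
`p₁₀₀ p₀₁₀ ≥ p₀₁₁ p₁₀₁`.  Stated on eight reals. [folklore] -/
theorem c1star_of_alone_ge (p011 p101 p100 p010 p001 p110 : ℝ) (h011 : 0 ≤ p011) (h101 : 0 ≤ p101)
    (h1 : p001 + p011 ≤ p100 + p110) (h2 : p001 + p101 ≤ p010 + p110) (hu : p110 ≤ p001) :
    p011 * p101 ≤ p100 * p010 := by
  nlinarith [mul_le_mul (by linarith : p011 ≤ p100) (by linarith : p101 ≤ p010) h101 (by linarith)]

/-- **(C1*) in the regime `(p₁₀₀ − p₁₁₁)(p₀₁₀ − p₁₁₁) ≥ 0 ∧ p₁₀₀ + p₀₁₀ ≥ p₀₀₁ + p₁₁₁`** (constants-miner 1, gen 4, regime D of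
`prim-rate-mine-1/CANDIDATES.md` §GEN-4 R20).  (C1*) is LINEAR in `g = p₁₁₁` given the single and pair cut probabilities:
`(C1*) ⟺ g·μ(v₁ Δ v₂) ≥ f₁₃f₂₃ − (p₁₀₀ − g)(p₀₁₀ − g)` with `f₁₃ = p₁₀₁ + g`, `f₂₃ = p₀₁₁ + g`, `μ(v₁ Δ v₂) = p₁₀₀ + p₁₀₁ + p₀₁₀ + p₀₁₁`; and
(V3) is `g·δ₃ ≥ f₁₃f₂₃` (`δ₃ = p₀₀₁ + p₀₁₁ + p₁₀₁ + g`).  Hence if `μ(v₁ Δ v₂) ≥ δ₃` (⟺ `p₁₀₀ + p₀₁₀ ≥ p₀₀₁ + g`) and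
`(p₁₀₀ − g)(p₀₁₀ − g) ≥ 0`, (C1*) follows from (V3) — no marginal hypothesis. [cite: VandenbergKahn2001, Thm 1.1 (p. 123)] -/
theorem c1star_of_regimeD (w : Sym2 (Fin n) → unitInterval) (a₀ v₁ v₂ v₃ : Fin n)
    (hsign : 0 ≤ ((prodBernoulli w).real ((openConn a₀ v₁)ᶜ ∩ openConn a₀ v₂ ∩ openConn a₀ v₃) -
        (prodBernoulli w).real ((openConn a₀ v₁)ᶜ ∩ (openConn a₀ v₂)ᶜ ∩ (openConn a₀ v₃)ᶜ)) *
      ((prodBernoulli w).real (openConn a₀ v₁ ∩ (openConn a₀ v₂)ᶜ ∩ openConn a₀ v₃) -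
        (prodBernoulli w).real ((openConn a₀ v₁)ᶜ ∩ (openConn a₀ v₂)ᶜ ∩ (openConn a₀ v₃)ᶜ)))
    (hmass : (prodBernoulli w).real (openConn a₀ v₁ ∩ openConn a₀ v₂ ∩ (openConn a₀ v₃)ᶜ) +
        (prodBernoulli w).real ((openConn a₀ v₁)ᶜ ∩ (openConn a₀ v₂)ᶜ ∩ (openConn a₀ v₃)ᶜ) ≤
      (prodBernoulli w).real ((openConn a₀ v₁)ᶜ ∩ openConn a₀ v₂ ∩ openConn a₀ v₃) +
        (prodBernoulli w).real (openConn a₀ v₁ ∩ (openConn a₀ v₂)ᶜ ∩ openConn a₀ v₃)) :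
    (prodBernoulli w).real (openConn a₀ v₁ ∩ (openConn a₀ v₂)ᶜ ∩ (openConn a₀ v₃)ᶜ) *
        (prodBernoulli w).real ((openConn a₀ v₁)ᶜ ∩ openConn a₀ v₂ ∩ (openConn a₀ v₃)ᶜ) ≤
      (prodBernoulli w).real ((openConn a₀ v₁)ᶜ ∩ openConn a₀ v₂ ∩ openConn a₀ v₃) *
        (prodBernoulli w).real (openConn a₀ v₁ ∩ (openConn a₀ v₂)ᶜ ∩ openConn a₀ v₃) := by
  set p011 := (prodBernoulli w).real (openConn a₀ v₁ ∩ (openConn a₀ v₂)ᶜ ∩ (openConn a₀ v₃)ᶜ) with hp011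
  set p101 := (prodBernoulli w).real ((openConn a₀ v₁)ᶜ ∩ openConn a₀ v₂ ∩ (openConn a₀ v₃)ᶜ) with hp101
  set p100 := (prodBernoulli w).real ((openConn a₀ v₁)ᶜ ∩ openConn a₀ v₂ ∩ openConn a₀ v₃) with hp100
  set p010 := (prodBernoulli w).real (openConn a₀ v₁ ∩ (openConn a₀ v₂)ᶜ ∩ openConn a₀ v₃) with hp010
  set p111 := (prodBernoulli w).real ((openConn a₀ v₁)ᶜ ∩ (openConn a₀ v₂)ᶜ ∩ (openConn a₀ v₃)ᶜ) with hp111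
  set p001 := (prodBernoulli w).real (openConn a₀ v₁ ∩ openConn a₀ v₂ ∩ (openConn a₀ v₃)ᶜ) with hp001
  have h3 : p011 * p101 ≤ p001 * p111 := vdBK_atoms₃ w a₀ v₁ v₂ v₃
  have h011 : 0 ≤ p011 := measureReal_nonneg
  have h101 : 0 ≤ p101 := measureReal_nonneg
  have h111 : 0 ≤ p111 := measureReal_nonneg
  have h001 : 0 ≤ p001 := measureReal_nonneg
  -- `p100·p010 = (p100 − p111)(p010 − p111) + p111(p100 + p010) − p111² ≥ 0 + p111(p001 + p111) − p111² = p001·p111`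
  nlinarith [hsign, mul_le_mul_of_nonneg_left hmass h111]

end HubOnly

end Summit.CriticalPhenomena.PercolationContinuityZ3.Theorems

end
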